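import Summits.QuantumFields.YangMills.Theses.TransverseWardBL
import Literature.MathematicalPhysics.QuantumFieldTheory.LatticeGaugeProofs
import Literature.MathematicalPhysics.QuantumLattice.HeatKernelGroupMeasureProofs
import HarnessLib

/-!
# Route `TransverseWardBL`, support `SMSubadd` (stmt-QuantumFields-23101): the Wilson-state second moment is a
positive quadratic functional of the test form

For the periodic Wilson `U(1)₄` theory on `(ℤ/(M+1))⁴` and a real plaquette 2-form `w` put
`f_w(U) = ∑_p w(p) sin θ_p(U)` and `SM(β, M, w) = ⟨f_w²⟩_{Λ_{M+1},β}`.  Then for every `η > 0`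
`SM(v + w) ≤ (1 + η) SM(v) + (1 + 1/η) SM(w)`: pointwise `f_{v+w} = f_v + f_w` and
`(a + b)² ≤ (1 + η) a² + (1 + 1/η) b²` (the difference is `(η a − b)²/η ≥ 0`), and the torus Wilson state is a
probability expectation at every real `β` (positivity and linearity; all integrands bounded and continuous).

Free-hands width seat `ym-line-sfw-p2-w4` (cell ym-idea-1) for planner ym-idea-4 g9 (LINE g9-C «ZeroModeFreeAssembly»).
THEOREMS ONLY; an elementary inequality between finite-volume `U(1)` expectations — nothing about the Yang–Mills mass gap
is proved, and no rung or crux is closed by this file.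

References: J. Fröhlich, T. Spencer, Comm. Math. Phys. **83** (1982) 411 [FrohlichSpencer1982] (context only).
-/

set_option autoImplicit false

noncomputable section

open MeasureTheory Finset
open scoped BigOperators
open Literature.MathematicalPhysics.QuantumFieldTheory Literature.MathematicalPhysics.QuantumLattice

namespace Summit.QuantumFields.YangMills.Theorems.TransverseWardBL

/-- The plaquette sine `U ↦ sin θ_p(U) = Im (plaquette holonomy)` of an arbitrary torus plaquette is continuous in the
configuration. [folklore] -/
theorem continuous_plaqIm (M : ℕ) (p : Plaquette 4 (M + 1)) :
    Continuous fun U : GaugeConfig 4 (M + 1) Circle =>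
      ((plaquetteHolonomy U p.1 p.2.1.1 p.2.1.2 : Circle) : ℂ).im :=
  Complex.continuous_im.comp
    (continuous_subtype_val.comp (continuous_plaquetteHolonomy (G := Circle) p.1 p.2.1.1 p.2.1.2))

/-- The smeared plaquette sine `f_w(U) = ∑_p w(p) sin θ_p(U)` is continuous in the configuration. [folklore] -/
theorem continuous_formSum (M : ℕ) (w : Plaquette 4 (M + 1) → ℝ) :
    Continuous fun U : GaugeConfig 4 (M + 1) Circle =>
      ∑ p : Plaquette 4 (M + 1), w p * ((plaquetteHolonomy U p.1 p.2.1.1 p.2.1.2 : Circle) : ℂ).im :=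
  continuous_finsetSum _ fun p _ => continuous_const.mul (continuous_plaqIm M p)

/-- Pointwise bound `|f_w(U)| ≤ ∑_p |w(p)|` (each plaquette sine has modulus at most `1`). [folklore] -/
theorem abs_formSum_le (M : ℕ) (w : Plaquette 4 (M + 1) → ℝ) (U : GaugeConfig 4 (M + 1) Circle) :
    |∑ p : Plaquette 4 (M + 1), w p * ((plaquetteHolonomy U p.1 p.2.1.1 p.2.1.2 : Circle) : ℂ).im| ≤
      ∑ p : Plaquette 4 (M + 1), |w p| := by
  refine (Finset.abs_sum_le_sum_abs _ _).trans (Finset.sum_le_sum fun p _ => ?_)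
  rw [abs_mul]
  exact mul_le_of_le_one_right (abs_nonneg _) ((Complex.abs_im_le_norm _).trans_eq (Circle.norm_coe _))

/-- The squared smeared plaquette sine `f_w²` is integrable for the torus Wilson state (bounded and continuous on a
probability space). [folklore] -/
theorem integrable_formSum_sq (β : ℝ) (M : ℕ) (w : Plaquette 4 (M + 1) → ℝ) :
    Integrable (fun U : GaugeConfig 4 (M + 1) Circle =>
      (∑ p : Plaquette 4 (M + 1), w p * ((plaquetteHolonomy U p.1 p.2.1.1 p.2.1.2 : Circle) : ℂ).im) ^ 2)
      (wilsonMeasure (L := M + 1) u1Rep β) := by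
  haveI := isProbabilityMeasure_wilsonMeasure (d := 4) (L := M + 1) u1Rep continuous_u1Rep β
  refine Integrable.of_bound ((continuous_formSum M w).pow 2).measurable.aestronglyMeasurable
    ((∑ p : Plaquette 4 (M + 1), |w p|) ^ 2) (ae_of_all _ fun U => ?_)
  rw [Real.norm_eq_abs, abs_pow]
  exact pow_le_pow_left₀ (abs_nonneg _) (abs_formSum_le M w U) 2

/-- The elementary inequality `(a + b)² ≤ (1 + η) a² + (1 + 1/η) b²` for `η > 0`
(the difference is `(η a − b)² / η`). [folklore] -/
private theorem add_sq_le_weighted (a b η : ℝ) (hη : 0 < η) :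
    (a + b) ^ 2 ≤ (1 + η) * a ^ 2 + (1 + 1 / η) * b ^ 2 := by
  have hkey : (1 + η) * a ^ 2 + (1 + 1 / η) * b ^ 2 - (a + b) ^ 2 = (η * a - b) ^ 2 / η := by
    field_simp
    ring
  have hnn : 0 ≤ (η * a - b) ^ 2 / η := div_nonneg (sq_nonneg _) hη.le
  linarith

/-- **`SMSubadd`** (item stmt-QuantumFields-23101), BY NAME: `SM(β,M,v+w) ≤ (1+η) SM(β,M,v) + (1+1/η) SM(β,M,w)` for every
real `β`, every `M`, all real plaquette 2-forms `v, w` and every `η > 0`. [folklore] -/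
theorem smSubadd_proof : Summit.QuantumFields.YangMills.Theses.TransverseWardBL.SMSubadd := by
  unfold Summit.QuantumFields.YangMills.Theses.TransverseWardBL.SMSubadd
  intro β M v w η hη
  simp only
  unfold wilsonExpectation
  haveI := isProbabilityMeasure_wilsonMeasure (d := 4) (L := M + 1) u1Rep continuous_u1Rep β
  have hv := integrable_formSum_sq β M v
  have hw := integrable_formSum_sq β M w
  have hvw := integrable_formSum_sq β M (fun p => v p + w p)
  rw [← integral_const_mul, ← integral_const_mul, ← integral_add (hv.const_mul _) (hw.const_mul _)]
  refine integral_mono hvw ((hv.const_mul _).add (hw.const_mul _)) fun U => ?_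
  have hsplit :
      (∑ p : Plaquette 4 (M + 1), (v p + w p) * ((plaquetteHolonomy U p.1 p.2.1.1 p.2.1.2 : Circle) : ℂ).im) =
        (∑ p : Plaquette 4 (M + 1), v p * ((plaquetteHolonomy U p.1 p.2.1.1 p.2.1.2 : Circle) : ℂ).im) +
          ∑ p : Plaquette 4 (M + 1), w p * ((plaquetteHolonomy U p.1 p.2.1.1 p.2.1.2 : Circle) : ℂ).im := by
    rw [← Finset.sum_add_distrib]
    exact Finset.sum_congr rfl fun p _ => add_mul _ _ _
  simp only [hsplit]
  exact add_sq_le_weighted _ _ η hη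

end Summit.QuantumFields.YangMills.Theorems.TransverseWardBL

end
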